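import Literature.MathematicalPhysics.QuantumFieldTheory.Balaban1983to89.B9Eq3126GreenLettersVariational

/-!
# `Balaban1983to89.B9Eq3126H1LipschitzEnergy` — T. Bałaban, *Propagators for lattice gauge theories in a background field*, Commun. Math. Phys. **99**
# (1985) 389–434 [Balaban1985BackgroundPropagators] (3.126) p. 420 *«HB = GQ*(QGQ*)⁻¹B»* with Thm 3.4 p. 400 ∕ (3.84)–(3.86) p. 407, and [Balaban1985Variational]
# (45) p. 285: **THE MINIMISER `H₁ = G₁Q†(QG₁Q†)⁻¹` IS LIPSCHITZ IN THE DATA `(Δ_a, Q)` IN THE ENERGY NORM — `N(H¹b − H⁰b)` FROM A STRONG COERCIVITY, A FORM DEFECT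
# OF THE TWO `Δ_a`, THE AVERAGING DEFECT `‖Q¹ − Q⁰‖` AND THE TWO `(QG₁Q†)⁻¹`-LETTERS ALONE — NO OPERATOR BOUND OF `Δ_a`, OF `Δ_a¹ − Δ_a⁰`, NO `H`-LETTER, NO NEUMANN
# SERIES** (abstract finite-dimensional `𝕜`-Hilbert letters for the pub-balaban NE9 chain's `B11Eq103H1Complex.H1K` ∕ `KinvK`)

statement-level skeleton of published theorems with citation tags; proofs where landed; nothing here is a claim about the Yang–Mills mass gap

CITATION HEADER (lean-in-tree rule).  Audit cell `pub-balaban`, sub-cell `t4`, BINDER row NE9; filed by the row OWNER lineage `b2b-balaban-t4-ne9-p1`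
(gen 86).  Sources READ first-hand in the held text layer [Balaban1985BackgroundPropagators] (`paper:balaban1985-cmp99-background-propagators`, journal page =
PDF page + 388) pp. 400 (Thm 3.4, (3.52)–(3.53)), 407 ((3.82)–(3.86)), 420 ((3.126)); [Balaban1985Variational] (45) p. 285 through the tree's quotations in
`B9Eq3126GreenLettersVariational` ∕ `B11Eq103H1Complex`.  THE PRINT (verbatim): [B9] p. 420 *«HB = GQ*(QGQ*)⁻¹B»*; [B11] p. 285 *«H … giving a minimum of the
quadratic form ½⟨A, ΔA⟩ under the restrictions L^jηQ_jA = B»*; [B9] p. 400 Thm 3.4 *«small perturbations of the operators depending on U only»*.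

WHY THIS FILE (the owner's programme «THE 𝔊-STOREY IN THE ENERGY CURRENCY», after D-ne9p1-g86-2).  The chart of `cur U` uses `H₁(U)` on the block data and is
consumed LIPSCHITZ IN THE BACKGROUND AT THE FLAT POINT; the chain's letter `B9Eq386LipschitzH1` ∕ `B9Eq386ResolventLetters.norm_H1K_sub_le` (g81) needs
OPERATOR bounds of `Δ_a` and of `Δ_a(U) − Δ_a(1)` (`∝ |η|⁻²`, level-dependent).  Here the MINIMISER does the work: with `x¹ = H¹b`, `x⁰ = H⁰b`, the correction
`h = H¹((Q⁰ − Q¹)x⁰)` and `z = x¹ − x⁰ − h ∈ ker Q¹`, the vectors `Δ_a¹x¹` and `Δ_a¹h` lie in `range Q¹†`, orthogonal to `z`, so EXACTLY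
`⟨z, Δ_a¹z⟩ = −⟨z, Δ_a¹x⁰⟩ = −(⟨z, Δ_a¹x⁰⟩ − ⟨z, Δ_a⁰x⁰⟩) − ⟨(Q⁰ − Q¹)z, K⁰⁻¹b⟩` — a form defect plus an averaging defect — and `⟨h, Δ_a¹h⟩ = ⟨c, K¹⁻¹c⟩` with
`‖c‖ ≤ δ_Q‖x⁰‖`.  Hence `N(z)`, `N(h)` and every row of `H¹b − H⁰b` are bounded by FORM data: the strong coercivity `γ` of `Δ_a¹` in the weight `N`, the coercivity
`γ₀` of `Δ_a⁰`, the defect `Θ`, `δ_Q`, and the two `K⁻¹`-letters (ne9-leaf-02's `B9Eq3126KFloor*` on the diagonal: flat `Ξ(d,a)`, windowed by the bond tent).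
The k-level instance (the owner's `B9Eq353FormDefectTowerDiagonal` supplies `γ`, `γ₀`, `Θ = Θ̄α`; `δ_Q = C_Qα`) is the sequel.

WHAT IS PROVED (sorry-free; 0 `def`; [folklore] finite-dimensional Hilbert-space algebra; nothing of [B9]∕[B11] asserted as printed).  Two structures `i = 0, 1` on the
same spaces: `Tᵢ = laplaceAK Δᵢ Dᵢ Rᵢ Dᵢ* Qᵢ Qᵢ† a`, `hposᵢ`, `hadjᵢ`, `hinjᵢ`, `Hᵢ := H1K hposᵢ hadjᵢ hinjᵢ`, `Kᵢ⁻¹ := KinvK hposᵢ hadjᵢ hinjᵢ`.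
* §1 **`inner_ker_laplaceAK_H1K`** (`⟪z, Δ_a(H₁b)⟫ = 0` for `Qz = 0`), **`laplaceAK_H1K_sub`** ∕ **`inner_defect_identity`** — the exact identity
  `⟪z, T¹z⟫ = −(⟪z, T¹x⁰⟫ − ⟪z, T⁰x⁰⟫) − ⟪Q⁰z − Q¹z, K⁰⁻¹b⟫` for `z = H¹b − H⁰b − H¹(b − Q¹(H⁰b))`; **`re_inner_H1K_energy_eq`** (`re⟪H₁c, Δ_a H₁c⟫ = re⟪c, K⁻¹c⟫`).
* §2 (a weight `N ≥ ‖·‖`, `γN(z)² ≤ re⟨z, T¹z⟩`, `γ₀N(z)² ≤ re⟨z, T⁰z⟩`, `‖⟨u, T¹v⟩ − ⟨u, T⁰v⟩‖ ≤ ΘN(u)N(v)`, `‖Q¹w − Q⁰w‖ ≤ δ_Q‖w‖`, `‖K⁰⁻¹b‖ ≤ C₀‖b‖`,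
  `‖K¹⁻¹c‖ ≤ C₁‖c‖`) **`weight_H1K_le`** (`N(H⁰b) ≤ √(C₀∕γ₀)‖b‖`), **`weight_defect_le`** (`N(z) ≤ γ⁻¹(ΘN(H⁰b) + δ_QC₀‖b‖)`), **`weight_correction_le`**
  (`N(h) ≤ √(C₁∕γ)·δ_Q·N(H⁰b)`), **`norm_apply_H1K_sub_le`** (for any `P` with `‖Pw‖ ≤ N(w)`:
  `‖P(H¹b − H⁰b)‖ ≤ (γ⁻¹(Θ + δ_Q√(γ₀C₀)) + √(C₁∕γ)δ_Q)·√(C₀∕γ₀)·‖b‖` — hence the plain norm and every flat `D`-row).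
MODEL ∕ HONEST SCOPE.  (M1) `E`, `F` finite-dimensional `𝕜`-Hilbert, `S` an inner-product space; `Q* := Q†`.  (M2) displayed: the two positivities, `γ`, `γ₀`, `Θ`, `δ_Q`,
`C₀`, `C₁`, the weight `N`.  (M3) FIRST order (two structures, e.g. `U` vs the flat point); no analyticity, no Neumann series, no kernel bound, no decay; crude constants.
NOT summit progress (cell pub-balaban: NE9 NOT PRINTED ∕ NOT PROVED; «NE9 ⇐ the named binders»; row WALLED ON A MODEL (O-NE9-1; #5 UNRULED); spine PROVED 0∕9;
rung (B)+1 finite T⁴ — NOT infinite volume, NOT mass gap, NOT BetaPertH, NOT Clay).  HONEST DEPENDENCY (cell line): continuum YM on T⁴ ⇐ BetaPertH ∧ nine spine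
estimates (0/9 proved); BetaPertH ⇐ (D1) ∧ (D4) ∧ CAP+tail; G-an2-4 gates asym, D1 and NE2/3/4.  NEW file importing `B9Eq3126GreenLettersVariational` (ne9-leaf-02)
only; nothing modified.  Net new unproved facts: 0.
-/

noncomputable section

open scoped InnerProductSpace ComplexConjugate BigOperators

namespace Literature.MathematicalPhysics.QuantumFieldTheory.Balaban1983to89.B9Eq3126H1LipschitzEnergy

open B11Eq103H1Complex (laplaceAK laplaceAK_apply G1K KinvK H1K laplaceAK_H1K Q_H1K)
open B9Eq3126GreenLettersVariational (inner_H1K_laplaceAK_H1K)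

section Abstract

variable {𝕜 : Type*} [RCLike 𝕜] {E : Type*} [NormedAddCommGroup E] [InnerProductSpace 𝕜 E] [FiniteDimensional 𝕜 E]
  {F : Type*} [NormedAddCommGroup F] [InnerProductSpace 𝕜 F] [FiniteDimensional 𝕜 F] {S : Type*} [NormedAddCommGroup S] [InnerProductSpace 𝕜 S]
  {V : Type*} [NormedAddCommGroup V] [InnerProductSpace 𝕜 V]
  {Δ₀ Δ₁ : E →ₗ[𝕜] E} {D₀ D₁ : S →ₗ[𝕜] E} {R₀ R₁ : S →ₗ[𝕜] S} {Dstar₀ Dstar₁ : E →ₗ[𝕜] S} {Q₀ Q₁ : E →ₗ[𝕜] F} {a : 𝕜}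
  (hpos₀ : ∀ x : E, x ≠ 0 → 0 < RCLike.re ⟪x, laplaceAK Δ₀ D₀ R₀ Dstar₀ Q₀ (LinearMap.adjoint Q₀) a x⟫_𝕜)
  (hadj₀ : ∀ (x : E) (y : F), ⟪Q₀ x, y⟫_𝕜 = ⟪x, LinearMap.adjoint Q₀ y⟫_𝕜) (hinj₀ : Function.Injective (LinearMap.adjoint Q₀))
  (hpos₁ : ∀ x : E, x ≠ 0 → 0 < RCLike.re ⟪x, laplaceAK Δ₁ D₁ R₁ Dstar₁ Q₁ (LinearMap.adjoint Q₁) a x⟫_𝕜)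
  (hadj₁ : ∀ (x : E) (y : F), ⟪Q₁ x, y⟫_𝕜 = ⟪x, LinearMap.adjoint Q₁ y⟫_𝕜) (hinj₁ : Function.Injective (LinearMap.adjoint Q₁))

/-! ## §1 The exact identities of the minimiser -/

/-- `⟪z, Δ_a(H₁c)⟫ = 0` whenever `Qz = 0` (`Δ_aH₁c = Q†K⁻¹c ∈ range Q†`). [folklore] [cite: Balaban1985Variational, (45) p.285, p.293; Balaban1985BackgroundPropagators, (3.126) p.420] -/
theorem inner_ker_laplaceAK_H1K {z : E} (hz : Q₁ z = 0) (c : F) :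
    ⟪z, laplaceAK Δ₁ D₁ R₁ Dstar₁ Q₁ (LinearMap.adjoint Q₁) a (H1K hpos₁ hadj₁ hinj₁ c)⟫_𝕜 = 0 := by
  rw [laplaceAK_H1K, ← hadj₁, hz, inner_zero_left]

/-- `re⟪H₁c, Δ_a(H₁c)⟫ = re⟪c, K⁻¹c⟫` (leaf-02's `inner_H1K_laplaceAK_H1K`, real parts). [folklore] [cite: Balaban1985Variational, (45) p.285] -/
theorem re_inner_H1K_energy_eq (c : F) :
    RCLike.re ⟪H1K hpos₁ hadj₁ hinj₁ c, laplaceAK Δ₁ D₁ R₁ Dstar₁ Q₁ (LinearMap.adjoint Q₁) a (H1K hpos₁ hadj₁ hinj₁ c)⟫_𝕜 =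
      RCLike.re ⟪c, KinvK hpos₁ hadj₁ hinj₁ c⟫_𝕜 := by
  rw [inner_H1K_laplaceAK_H1K]

/-- The defect vector `z = H¹b − H⁰b − H¹(b − Q¹(H⁰b))` lies in `ker Q¹`. [folklore] [cite: Balaban1985Variational, (45) p.285] -/
theorem Q_defect_eq_zero (b : F) :
    Q₁ (H1K hpos₁ hadj₁ hinj₁ b - H1K hpos₀ hadj₀ hinj₀ b - H1K hpos₁ hadj₁ hinj₁ (b - Q₁ (H1K hpos₀ hadj₀ hinj₀ b))) = 0 := by
  rw [map_sub, map_sub, Q_H1K, Q_H1K]; abel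

/-- **THE EXACT DEFECT IDENTITY**: with `x⁰ = H⁰b`, `z = H¹b − x⁰ − H¹(b − Q¹x⁰)`,
`⟪z, T¹z⟫ = −(⟪z, T¹x⁰⟫ − ⟪z, T⁰x⁰⟫) − ⟪Q⁰z − Q¹z, K⁰⁻¹b⟫` — the two `range Q¹†`-terms drop (`z ∈ ker Q¹`) and `⟪z, T⁰x⁰⟫ = ⟪Q⁰z, K⁰⁻¹b⟫ = ⟪Q⁰z − Q¹z, K⁰⁻¹b⟫`.
[folklore] [cite: Balaban1985Variational, (45) p.285, (129) p.297; Balaban1985BackgroundPropagators, (3.126) p.420, (3.84) p.407] -/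
theorem inner_defect_identity (b : F) :
    ⟪H1K hpos₁ hadj₁ hinj₁ b - H1K hpos₀ hadj₀ hinj₀ b - H1K hpos₁ hadj₁ hinj₁ (b - Q₁ (H1K hpos₀ hadj₀ hinj₀ b)),
        laplaceAK Δ₁ D₁ R₁ Dstar₁ Q₁ (LinearMap.adjoint Q₁) a
          (H1K hpos₁ hadj₁ hinj₁ b - H1K hpos₀ hadj₀ hinj₀ b - H1K hpos₁ hadj₁ hinj₁ (b - Q₁ (H1K hpos₀ hadj₀ hinj₀ b)))⟫_𝕜 =
      -(⟪H1K hpos₁ hadj₁ hinj₁ b - H1K hpos₀ hadj₀ hinj₀ b - H1K hpos₁ hadj₁ hinj₁ (b - Q₁ (H1K hpos₀ hadj₀ hinj₀ b)),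
            laplaceAK Δ₁ D₁ R₁ Dstar₁ Q₁ (LinearMap.adjoint Q₁) a (H1K hpos₀ hadj₀ hinj₀ b)⟫_𝕜 -
          ⟪H1K hpos₁ hadj₁ hinj₁ b - H1K hpos₀ hadj₀ hinj₀ b - H1K hpos₁ hadj₁ hinj₁ (b - Q₁ (H1K hpos₀ hadj₀ hinj₀ b)),
            laplaceAK Δ₀ D₀ R₀ Dstar₀ Q₀ (LinearMap.adjoint Q₀) a (H1K hpos₀ hadj₀ hinj₀ b)⟫_𝕜) -
        ⟪Q₀ (H1K hpos₁ hadj₁ hinj₁ b - H1K hpos₀ hadj₀ hinj₀ b - H1K hpos₁ hadj₁ hinj₁ (b - Q₁ (H1K hpos₀ hadj₀ hinj₀ b))) -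
            Q₁ (H1K hpos₁ hadj₁ hinj₁ b - H1K hpos₀ hadj₀ hinj₀ b - H1K hpos₁ hadj₁ hinj₁ (b - Q₁ (H1K hpos₀ hadj₀ hinj₀ b))),
          KinvK hpos₀ hadj₀ hinj₀ b⟫_𝕜 := by
  set z := H1K hpos₁ hadj₁ hinj₁ b - H1K hpos₀ hadj₀ hinj₀ b - H1K hpos₁ hadj₁ hinj₁ (b - Q₁ (H1K hpos₀ hadj₀ hinj₀ b)) with hzdef
  have hz : Q₁ z = 0 := Q_defect_eq_zero hpos₀ hadj₀ hinj₀ hpos₁ hadj₁ hinj₁ b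
  have h1 : ⟪z, laplaceAK Δ₁ D₁ R₁ Dstar₁ Q₁ (LinearMap.adjoint Q₁) a (H1K hpos₁ hadj₁ hinj₁ b)⟫_𝕜 = 0 := inner_ker_laplaceAK_H1K hpos₁ hadj₁ hinj₁ hz b
  have h2 : ⟪z, laplaceAK Δ₁ D₁ R₁ Dstar₁ Q₁ (LinearMap.adjoint Q₁) a (H1K hpos₁ hadj₁ hinj₁ (b - Q₁ (H1K hpos₀ hadj₀ hinj₀ b)))⟫_𝕜 = 0 :=
    inner_ker_laplaceAK_H1K hpos₁ hadj₁ hinj₁ hz _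
  have h3 : ⟪z, laplaceAK Δ₀ D₀ R₀ Dstar₀ Q₀ (LinearMap.adjoint Q₀) a (H1K hpos₀ hadj₀ hinj₀ b)⟫_𝕜 = ⟪Q₀ z - Q₁ z, KinvK hpos₀ hadj₀ hinj₀ b⟫_𝕜 := by
    rw [laplaceAK_H1K, ← hadj₀, hz, sub_zero]
  -- expand `T¹z` along `z = x¹ − x⁰ − h`
  have hTz : laplaceAK Δ₁ D₁ R₁ Dstar₁ Q₁ (LinearMap.adjoint Q₁) a z =
      laplaceAK Δ₁ D₁ R₁ Dstar₁ Q₁ (LinearMap.adjoint Q₁) a (H1K hpos₁ hadj₁ hinj₁ b) -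
        laplaceAK Δ₁ D₁ R₁ Dstar₁ Q₁ (LinearMap.adjoint Q₁) a (H1K hpos₀ hadj₀ hinj₀ b) -
        laplaceAK Δ₁ D₁ R₁ Dstar₁ Q₁ (LinearMap.adjoint Q₁) a (H1K hpos₁ hadj₁ hinj₁ (b - Q₁ (H1K hpos₀ hadj₀ hinj₀ b))) := by
    rw [hzdef, map_sub, map_sub]
  rw [hTz, inner_sub_right, inner_sub_right, h1, h2, h3, zero_sub, sub_zero]
  ring

/-! ## §2 Bounds from the form data -/

variable (N : E → ℝ) (hN : ∀ w, 0 ≤ N w) (hNn : ∀ w, ‖w‖ ≤ N w) {γ γ₀ Θ δQ C₀ C₁ : ℝ} (hγ : 0 < γ) (hγ₀ : 0 < γ₀) (hΘ : 0 ≤ Θ) (hδQ : 0 ≤ δQ)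
  (hC₀ : 0 ≤ C₀) (hC₁ : 0 ≤ C₁)
  (hcoer₁ : ∀ z : E, γ * N z ^ 2 ≤ RCLike.re ⟪z, laplaceAK Δ₁ D₁ R₁ Dstar₁ Q₁ (LinearMap.adjoint Q₁) a z⟫_𝕜)
  (hcoer₀ : ∀ z : E, γ₀ * N z ^ 2 ≤ RCLike.re ⟪z, laplaceAK Δ₀ D₀ R₀ Dstar₀ Q₀ (LinearMap.adjoint Q₀) a z⟫_𝕜)
  (hT : ∀ u v : E, ‖⟪u, laplaceAK Δ₁ D₁ R₁ Dstar₁ Q₁ (LinearMap.adjoint Q₁) a v⟫_𝕜 - ⟪u, laplaceAK Δ₀ D₀ R₀ Dstar₀ Q₀ (LinearMap.adjoint Q₀) a v⟫_𝕜‖ ≤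
    Θ * N u * N v)
  (hQd : ∀ w : E, ‖Q₁ w - Q₀ w‖ ≤ δQ * ‖w‖)
  (hK₀ : ∀ b : F, ‖KinvK hpos₀ hadj₀ hinj₀ b‖ ≤ C₀ * ‖b‖) (hK₁ : ∀ c : F, ‖KinvK hpos₁ hadj₁ hinj₁ c‖ ≤ C₁ * ‖c‖)

/-- From `N z ≥ 0`, `γ N z² ≤ B·N z` with `B ≥ 0` conclude `N z ≤ B∕γ`. [folklore] -/
private theorem le_div_of_mul_sq_le {x γ B : ℝ} (hx : 0 ≤ x) (hγ : 0 < γ) (hB : 0 ≤ B) (h : γ * x ^ 2 ≤ B * x) : x ≤ B / γ := by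
  by_cases h0 : x = 0
  · rw [h0]; exact div_nonneg hB hγ.le
  · have hx' : 0 < x := lt_of_le_of_ne hx (Ne.symm h0)
    rw [le_div_iff₀ hγ]
    have h2 : (x * γ) * x ≤ B * x := by calc (x * γ) * x = γ * x ^ 2 := by ring
      _ ≤ B * x := h
    exact le_of_mul_le_mul_right h2 hx'

/-- `x ≤ B` from `0 ≤ x`, `0 ≤ B` and `x² ≤ B²`. [folklore] -/
private theorem le_of_sq_le_sq' {x B : ℝ} (hx : 0 ≤ x) (hB : 0 ≤ B) (h : x ^ 2 ≤ B ^ 2) : x ≤ B := by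
  calc x = Real.sqrt (x ^ 2) := (Real.sqrt_sq hx).symm
    _ ≤ Real.sqrt (B ^ 2) := Real.sqrt_le_sqrt h
    _ = B := Real.sqrt_sq hB

include hN hγ₀ hC₀ hcoer₀ hK₀ in
/-- **`N(H⁰b) ≤ √(C₀∕γ₀)‖b‖`** — the rows of the comparison minimiser from its strong coercivity and its `K⁻¹`-letter
(`γ₀N(H⁰b)² ≤ re⟨H⁰b, T⁰H⁰b⟩ = re⟨b, K⁰⁻¹b⟩ ≤ C₀‖b‖²`). [folklore] [cite: Balaban1985Variational, (45)–(46) p.285; Balaban1985BackgroundPropagators, (3.126) p.420] -/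
theorem weight_H1K_le (b : F) : N (H1K hpos₀ hadj₀ hinj₀ b) ≤ Real.sqrt (C₀ / γ₀) * ‖b‖ := by
  have h1 : γ₀ * N (H1K hpos₀ hadj₀ hinj₀ b) ^ 2 ≤ C₀ * ‖b‖ ^ 2 := by
    calc γ₀ * N (H1K hpos₀ hadj₀ hinj₀ b) ^ 2 ≤ RCLike.re ⟪H1K hpos₀ hadj₀ hinj₀ b,
          laplaceAK Δ₀ D₀ R₀ Dstar₀ Q₀ (LinearMap.adjoint Q₀) a (H1K hpos₀ hadj₀ hinj₀ b)⟫_𝕜 := hcoer₀ _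
      _ = RCLike.re ⟪b, KinvK hpos₀ hadj₀ hinj₀ b⟫_𝕜 := re_inner_H1K_energy_eq hpos₀ hadj₀ hinj₀ b
      _ ≤ ‖b‖ * ‖KinvK hpos₀ hadj₀ hinj₀ b‖ := re_inner_le_norm _ _
      _ ≤ ‖b‖ * (C₀ * ‖b‖) := mul_le_mul_of_nonneg_left (hK₀ b) (norm_nonneg _)
      _ = C₀ * ‖b‖ ^ 2 := by ring
  refine le_of_sq_le_sq' (hN _) (by positivity) ?_
  rw [mul_pow, Real.sq_sqrt (div_nonneg hC₀ hγ₀.le), div_mul_eq_mul_div, le_div_iff₀ hγ₀]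
  calc N (H1K hpos₀ hadj₀ hinj₀ b) ^ 2 * γ₀ = γ₀ * N (H1K hpos₀ hadj₀ hinj₀ b) ^ 2 := by ring
    _ ≤ C₀ * ‖b‖ ^ 2 := h1

include hN hNn hγ hΘ hδQ hC₀ hcoer₁ hT hQd hK₀ in
/-- **THE DEFECT VECTOR**: `N(z) ≤ γ⁻¹(Θ·N(H⁰b) + δ_QC₀‖b‖)` for `z = H¹b − H⁰b − H¹(b − Q¹(H⁰b))` — the exact identity of §1, the form defect and the
averaging defect. [folklore] [cite: Balaban1985BackgroundPropagators, Thm 3.4 p.400, (3.84) p.407, (3.126) p.420; Balaban1985Variational, (45) p.285] -/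
theorem weight_defect_le (b : F) :
    N (H1K hpos₁ hadj₁ hinj₁ b - H1K hpos₀ hadj₀ hinj₀ b - H1K hpos₁ hadj₁ hinj₁ (b - Q₁ (H1K hpos₀ hadj₀ hinj₀ b))) ≤
      (Θ * N (H1K hpos₀ hadj₀ hinj₀ b) + δQ * (C₀ * ‖b‖)) / γ := by
  set z := H1K hpos₁ hadj₁ hinj₁ b - H1K hpos₀ hadj₀ hinj₀ b - H1K hpos₁ hadj₁ hinj₁ (b - Q₁ (H1K hpos₀ hadj₀ hinj₀ b)) with hzdef
  set x₀ := H1K hpos₀ hadj₀ hinj₀ b with hx₀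
  have hid := inner_defect_identity (a := a) hpos₀ hadj₀ hinj₀ hpos₁ hadj₁ hinj₁ b
  rw [← hzdef, ← hx₀] at hid
  have hB : 0 ≤ Θ * N x₀ + δQ * (C₀ * ‖b‖) := by
    have := hN x₀; positivity
  refine le_div_of_mul_sq_le (hN z) hγ hB ?_
  calc γ * N z ^ 2 ≤ RCLike.re ⟪z, laplaceAK Δ₁ D₁ R₁ Dstar₁ Q₁ (LinearMap.adjoint Q₁) a z⟫_𝕜 := hcoer₁ z
    _ = RCLike.re (-(⟪z, laplaceAK Δ₁ D₁ R₁ Dstar₁ Q₁ (LinearMap.adjoint Q₁) a x₀⟫_𝕜 -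
            ⟪z, laplaceAK Δ₀ D₀ R₀ Dstar₀ Q₀ (LinearMap.adjoint Q₀) a x₀⟫_𝕜) - ⟪Q₀ z - Q₁ z, KinvK hpos₀ hadj₀ hinj₀ b⟫_𝕜) := by rw [hid]
    _ ≤ ‖-(⟪z, laplaceAK Δ₁ D₁ R₁ Dstar₁ Q₁ (LinearMap.adjoint Q₁) a x₀⟫_𝕜 -
            ⟪z, laplaceAK Δ₀ D₀ R₀ Dstar₀ Q₀ (LinearMap.adjoint Q₀) a x₀⟫_𝕜) - ⟪Q₀ z - Q₁ z, KinvK hpos₀ hadj₀ hinj₀ b⟫_𝕜‖ := RCLike.re_le_norm _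
    _ ≤ ‖⟪z, laplaceAK Δ₁ D₁ R₁ Dstar₁ Q₁ (LinearMap.adjoint Q₁) a x₀⟫_𝕜 - ⟪z, laplaceAK Δ₀ D₀ R₀ Dstar₀ Q₀ (LinearMap.adjoint Q₀) a x₀⟫_𝕜‖ +
          ‖⟪Q₀ z - Q₁ z, KinvK hpos₀ hadj₀ hinj₀ b⟫_𝕜‖ := by
        refine (norm_sub_le _ _).trans (add_le_add ?_ le_rfl); rw [norm_neg]
    _ ≤ Θ * N z * N x₀ + ‖Q₀ z - Q₁ z‖ * ‖KinvK hpos₀ hadj₀ hinj₀ b‖ := add_le_add (hT z x₀) (norm_inner_le_norm _ _)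
    _ ≤ Θ * N z * N x₀ + (δQ * N z) * (C₀ * ‖b‖) := by
        refine add_le_add le_rfl (mul_le_mul ?_ (hK₀ b) (norm_nonneg _) (mul_nonneg hδQ (hN z)))
        rw [← norm_neg, neg_sub]; exact (hQd z).trans (mul_le_mul_of_nonneg_left (hNn z) hδQ)
    _ = (Θ * N x₀ + δQ * (C₀ * ‖b‖)) * N z := by ring

include hN hNn hγ hδQ hC₁ hcoer₁ hQd hK₁ in
/-- **THE CORRECTION**: `N(H¹c) ≤ √(C₁∕γ)‖c‖` and, for `c = b − Q¹(H⁰b) = (Q⁰ − Q¹)(H⁰b)`, `‖c‖ ≤ δ_Q·N(H⁰b)`. [folklore]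
[cite: Balaban1985Variational, (45)–(46) p.285; Balaban1985BackgroundPropagators, (3.126) p.420] -/
theorem weight_correction_le (b : F) :
    N (H1K hpos₁ hadj₁ hinj₁ (b - Q₁ (H1K hpos₀ hadj₀ hinj₀ b))) ≤ Real.sqrt (C₁ / γ) * (δQ * N (H1K hpos₀ hadj₀ hinj₀ b)) := by
  set c := b - Q₁ (H1K hpos₀ hadj₀ hinj₀ b) with hc
  have hcn : ‖c‖ ≤ δQ * N (H1K hpos₀ hadj₀ hinj₀ b) := by
    have h1 : c = Q₀ (H1K hpos₀ hadj₀ hinj₀ b) - Q₁ (H1K hpos₀ hadj₀ hinj₀ b) := by rw [hc, Q_H1K]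
    rw [h1, ← norm_neg, neg_sub]
    exact (hQd _).trans (mul_le_mul_of_nonneg_left (hNn _) hδQ)
  have h1 : γ * N (H1K hpos₁ hadj₁ hinj₁ c) ^ 2 ≤ C₁ * ‖c‖ ^ 2 := by
    calc γ * N (H1K hpos₁ hadj₁ hinj₁ c) ^ 2 ≤ RCLike.re ⟪H1K hpos₁ hadj₁ hinj₁ c,
          laplaceAK Δ₁ D₁ R₁ Dstar₁ Q₁ (LinearMap.adjoint Q₁) a (H1K hpos₁ hadj₁ hinj₁ c)⟫_𝕜 := hcoer₁ _
      _ = RCLike.re ⟪c, KinvK hpos₁ hadj₁ hinj₁ c⟫_𝕜 := re_inner_H1K_energy_eq hpos₁ hadj₁ hinj₁ c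
      _ ≤ ‖c‖ * ‖KinvK hpos₁ hadj₁ hinj₁ c‖ := re_inner_le_norm _ _
      _ ≤ ‖c‖ * (C₁ * ‖c‖) := mul_le_mul_of_nonneg_left (hK₁ c) (norm_nonneg _)
      _ = C₁ * ‖c‖ ^ 2 := by ring
  have h2 : N (H1K hpos₁ hadj₁ hinj₁ c) ≤ Real.sqrt (C₁ / γ) * ‖c‖ := by
    refine le_of_sq_le_sq' (hN _) (by positivity) ?_
    rw [mul_pow, Real.sq_sqrt (div_nonneg hC₁ hγ.le), div_mul_eq_mul_div, le_div_iff₀ hγ]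
    calc N (H1K hpos₁ hadj₁ hinj₁ c) ^ 2 * γ = γ * N (H1K hpos₁ hadj₁ hinj₁ c) ^ 2 := by ring
      _ ≤ C₁ * ‖c‖ ^ 2 := h1
  exact h2.trans (mul_le_mul_of_nonneg_left hcn (Real.sqrt_nonneg _))

include hN hNn hγ hγ₀ hΘ hδQ hC₀ hC₁ hcoer₁ hcoer₀ hT hQd hK₀ hK₁ in
/-- **`H₁` IS LIPSCHITZ IN THE DATA IN THE ENERGY NORM**: for every operator `P` dominated by the weight (`‖Pw‖ ≤ N(w)`: the identity, the flat `D`-rows),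
`‖P(H¹b − H⁰b)‖ ≤ ((Θ·√(C₀∕γ₀) + δ_QC₀)∕γ + √(C₁∕γ)·δ_Q·√(C₀∕γ₀))·‖b‖` — `H¹b − H⁰b = z + h`, `‖P·‖ ≤ N(z) + N(h)`.  No operator bound of `Δ_a`,
`Δ_a¹ − Δ_a⁰`, `D`, `Q`, no `H`-letter. [cite: Balaban1985BackgroundPropagators, Thm 3.4 p.400, (3.84)–(3.86) p.407, (3.126) p.420; Balaban1985Variational, (45)–(46) p.285] -/
theorem norm_apply_H1K_sub_le (P : E →ₗ[𝕜] V) (hP : ∀ w : E, ‖P w‖ ≤ N w) (b : F) :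
    ‖P (H1K hpos₁ hadj₁ hinj₁ b - H1K hpos₀ hadj₀ hinj₀ b)‖ ≤
      ((Θ * Real.sqrt (C₀ / γ₀) + δQ * C₀) / γ + Real.sqrt (C₁ / γ) * (δQ * Real.sqrt (C₀ / γ₀))) * ‖b‖ := by
  set z := H1K hpos₁ hadj₁ hinj₁ b - H1K hpos₀ hadj₀ hinj₀ b - H1K hpos₁ hadj₁ hinj₁ (b - Q₁ (H1K hpos₀ hadj₀ hinj₀ b)) with hzdef
  set h := H1K hpos₁ hadj₁ hinj₁ (b - Q₁ (H1K hpos₀ hadj₀ hinj₀ b)) with hh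
  have hsplit : H1K hpos₁ hadj₁ hinj₁ b - H1K hpos₀ hadj₀ hinj₀ b = z + h := by rw [hzdef]; abel
  have hx₀ := weight_H1K_le hpos₀ hadj₀ hinj₀ N hN hγ₀ hC₀ hcoer₀ hK₀ b
  have hz := weight_defect_le hpos₀ hadj₀ hinj₀ hpos₁ hadj₁ hinj₁ N hN hNn hγ hΘ hδQ hC₀ hcoer₁ hT hQd hK₀ b
  have hh' := weight_correction_le hpos₀ hadj₀ hinj₀ hpos₁ hadj₁ hinj₁ N hN hNn hγ hδQ hC₁ hcoer₁ hQd hK₁ b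
  rw [← hzdef] at hz; rw [← hh] at hh'
  have hz' : N z ≤ (Θ * Real.sqrt (C₀ / γ₀) + δQ * C₀) / γ * ‖b‖ := by
    refine hz.trans ?_
    rw [div_mul_eq_mul_div]
    refine div_le_div_of_nonneg_right ?_ hγ.le
    have h1 : Θ * N (H1K hpos₀ hadj₀ hinj₀ b) ≤ Θ * (Real.sqrt (C₀ / γ₀) * ‖b‖) := mul_le_mul_of_nonneg_left hx₀ hΘ
    calc Θ * N (H1K hpos₀ hadj₀ hinj₀ b) + δQ * (C₀ * ‖b‖) ≤ Θ * (Real.sqrt (C₀ / γ₀) * ‖b‖) + δQ * (C₀ * ‖b‖) := add_le_add h1 le_rfl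
      _ = (Θ * Real.sqrt (C₀ / γ₀) + δQ * C₀) * ‖b‖ := by ring
  have hh2 : N h ≤ Real.sqrt (C₁ / γ) * (δQ * Real.sqrt (C₀ / γ₀)) * ‖b‖ := by
    refine hh'.trans ?_
    have h1 : δQ * N (H1K hpos₀ hadj₀ hinj₀ b) ≤ δQ * (Real.sqrt (C₀ / γ₀) * ‖b‖) := mul_le_mul_of_nonneg_left hx₀ hδQ
    calc Real.sqrt (C₁ / γ) * (δQ * N (H1K hpos₀ hadj₀ hinj₀ b)) ≤ Real.sqrt (C₁ / γ) * (δQ * (Real.sqrt (C₀ / γ₀) * ‖b‖)) :=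
          mul_le_mul_of_nonneg_left h1 (Real.sqrt_nonneg _)
      _ = Real.sqrt (C₁ / γ) * (δQ * Real.sqrt (C₀ / γ₀)) * ‖b‖ := by ring
  rw [hsplit, map_add]
  calc ‖P z + P h‖ ≤ ‖P z‖ + ‖P h‖ := norm_add_le _ _
    _ ≤ N z + N h := add_le_add (hP z) (hP h)
    _ ≤ (Θ * Real.sqrt (C₀ / γ₀) + δQ * C₀) / γ * ‖b‖ + Real.sqrt (C₁ / γ) * (δQ * Real.sqrt (C₀ / γ₀)) * ‖b‖ := add_le_add hz' hh2
    _ = ((Θ * Real.sqrt (C₀ / γ₀) + δQ * C₀) / γ + Real.sqrt (C₁ / γ) * (δQ * Real.sqrt (C₀ / γ₀))) * ‖b‖ := by ring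

end Abstract

end Literature.MathematicalPhysics.QuantumFieldTheory.Balaban1983to89.B9Eq3126H1LipschitzEnergy

end
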